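import Literature.MathematicalPhysics.QuantumLattice.BlockProductStates
import Literature.MathematicalPhysics.QuantumLattice.HubbardJordanWigner
import Summits.Ventures.CertifiedManyBodySolver.Upper.UMPSDualBoundBridge

/-!
# Super-site blocking of a quantum spin system along a cell decomposition, and Jordan–Wigner words

HONEST FRAMING: first certified bounds; not a superconductivity verdict; every number certified or
labelled float.

Venture `Ventures/CertifiedManyBodySolver` (sr-mbsolver), K1-GATE «writer (ii)» piece (α) of the route pen's
`WRITER-II-SPEC.md` (sr-mbsolver-var-7), GENERIC PART: the uMPS tensor side (`Upper/UMPSDualBound.lean`) is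
stated for a chain `Op (Fin N) Q` of super-sites with a nearest-neighbour `bondSum`; `Upper/UMPSCellBlocking.lean`
blocks the chain `Op (Fin (C·2)) 4` into two-site cells. This file does the same for an ARBITRARY cell
decomposition `e : Λ ≃ B × F` (cell label, position in the cell) and an arbitrary enumeration
`κ : TensorIndex F q ≃ Fin Q` of the cell configurations (no digit order is fixed here; `Q = q ^ |F|`):

* `superSite κ : Op F q ≃ₐ[ℂ] Matrix (Fin Q) (Fin Q) ℂ` — a cell operator read as a `Q × Q` matrix;
* `superCfg e κ : TensorIndex Λ q ≃ TensorIndex B Q`, `superOp e κ : Op Λ q ≃ₐ[ℂ] Op B Q` — blocking of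
  configurations and of operators (`superCfg = blockCfgEquiv e` of `BlockProductStates` followed by `κ`);
* `superOp_productOp` — **a product operator blocks to the product operator of the cell words**
  `superOp (⨂_x u_x) = ⨂_b superSite (⨂_f u_{e⁻¹(b,f)})`; hence `superOp_onSite`,
  `superOp_productOp_of_support` (one cell ⇒ `onSite`), `superOp_productOp_of_support₂` (two cells ⇒
  `onSite · onSite`), `superOp_sum_onSite` (sums of one-site terms block cell by cell);
* `star_dotProduct_superOp_mulVec`, `star_comp_superCfg_dotProduct_mulVec` — quadratic forms are invariant;
* Jordan–Wigner words as product operators (`q = 4`, `Λ` linearly ordered): `stringFamily x y`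
  (`jwString x * jwString y = ⨂ stringFamily x y`), `jwWordFamily x y A B`
  (`A_x · F_x F_y · B_y = ⨂ jwWordFamily x y A B`, `toSpin (c†_{xσ} c_{yτ}) = ⨂ jwWordFamily …`), and their
  transport along an ORDER EMBEDDING `ι : F ↪o Λ` with order-connected range (a cell that is an interval
  of the Jordan–Wigner order): `jwWordFamily (ι p) (ι p') A B ∘ ι = jwWordFamily p p' A B` and `= 1` off
  the range — so a hopping word inside an interval cell blocks to `onSite b (superSite (cell word))`
  (`superOp_productOp_jwWordFamily_cell`).

The STRIP instance (cells of `c` columns of the open strip, the inter-cell words, `stripCellBondMatrix`) is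
`Upper/StripCellHamiltonian.lean`. Nothing here is a claim about any number.
References: route pen's `HOME/sr-mbsolver-var-7/R2c-bc3/WRITER-II-SPEC.md` §1 (α); Essler–Frahm–Göhmann–Klümper–
Korepin, *The One-Dimensional Hubbard Model* (2005) §12.3.4 (Jordan–Wigner strings, as in
`HubbardJordanWigner.lean`); H. Tasaki, *Physics and Mathematics of Quantum Many-Body Systems* (2020) §2.2.
-/

noncomputable section

open Matrix Finset
open scoped ComplexOrder BigOperators Kronecker

namespace Summit.Ventures.CertifiedManyBodySolver.Upper

open Literature.MathematicalPhysics.QuantumLattice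

/-! ### Super-sites: cell operators as `Q × Q` matrices -/

section SuperSite

variable {F : Type*} [Fintype F] [DecidableEq F] {q Q : ℕ}

/-- A cell operator (on the sites `F`, `q` states each) read as a `Q × Q` matrix along an enumeration
`κ : (F → Fin q) ≃ Fin Q` of the cell configurations (reindexing; an algebra isomorphism). -/
def superSite (κ : TensorIndex F q ≃ Fin Q) : Op F q ≃ₐ[ℂ] Matrix (Fin Q) (Fin Q) ℂ :=
  Matrix.reindexAlgEquiv ℂ ℂ κ

/-- Entries of `superSite κ O`. -/
theorem superSite_apply (κ : TensorIndex F q ≃ Fin Q) (O : Op F q) (S S' : Fin Q) :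
    superSite κ O S S' = O (κ.symm S) (κ.symm S') := rfl

/-- `superSite` commutes with the conjugate transpose. -/
theorem superSite_conjTranspose (κ : TensorIndex F q ≃ Fin Q) (O : Op F q) :
    superSite κ Oᴴ = (superSite κ O)ᴴ := by
  ext S S'
  simp [superSite_apply, Matrix.conjTranspose_apply]

/-- `superSite` preserves positive semidefiniteness (reindexing along an equivalence). -/
theorem posSemidef_superSite_iff (κ : TensorIndex F q ≃ Fin Q) (O : Op F q) :
    (superSite κ O).PosSemidef ↔ O.PosSemidef :=
  Matrix.posSemidef_submatrix_equiv κ.symm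

end SuperSite

/-! ### Blocking configurations and operators along a cell decomposition -/

section Blocking

variable {Λ B F : Type*} [Fintype Λ] [DecidableEq Λ] [Fintype B] [DecidableEq B] [Fintype F]
  [DecidableEq F] {q Q : ℕ}

/-- Blocking of configurations along the cell decomposition `e : Λ ≃ B × F` (cell label, position in the
cell) and the cell enumeration `κ`: `σ ↦ (b ↦ κ (f ↦ σ (e⁻¹ (b, f))))`. -/
def superCfg (e : Λ ≃ B × F) (κ : TensorIndex F q ≃ Fin Q) : TensorIndex Λ q ≃ TensorIndex B Q :=
  (blockCfgEquiv e).trans (Equiv.piCongrRight fun _ => κ)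

omit [Fintype Λ] [DecidableEq Λ] [Fintype B] [DecidableEq B] [Fintype F] [DecidableEq F] in
/-- `superCfg e κ σ b = κ (σ|_{cell b})`. -/
theorem superCfg_apply (e : Λ ≃ B × F) (κ : TensorIndex F q ≃ Fin Q) (σ : TensorIndex Λ q) (b : B) :
    superCfg e κ σ b = κ (fun f => σ (e.symm (b, f))) := rfl

omit [Fintype Λ] [DecidableEq Λ] [Fintype B] [DecidableEq B] [Fintype F] [DecidableEq F] in
/-- The unblocked configuration: `(superCfg e κ)⁻¹ τ x = (κ⁻¹ (τ (e x).1)) (e x).2`. -/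
theorem superCfg_symm_apply (e : Λ ≃ B × F) (κ : TensorIndex F q ≃ Fin Q) (τ : TensorIndex B Q)
    (x : Λ) : (superCfg e κ).symm τ x = κ.symm (τ (e x).1) (e x).2 := rfl

omit [Fintype Λ] [DecidableEq Λ] [Fintype B] [DecidableEq B] [Fintype F] [DecidableEq F] in
/-- The unblocked configuration at the site `e⁻¹ (b, f)`. -/
theorem superCfg_symm_apply_symm (e : Λ ≃ B × F) (κ : TensorIndex F q ≃ Fin Q)
    (τ : TensorIndex B Q) (b : B) (f : F) :
    (superCfg e κ).symm τ (e.symm (b, f)) = κ.symm (τ b) f := by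
  rw [superCfg_symm_apply, Equiv.apply_symm_apply]

/-- Blocking of operators: `Op Λ q ≃ₐ[ℂ] Op B Q` (reindexing along `superCfg e κ`). -/
def superOp (e : Λ ≃ B × F) (κ : TensorIndex F q ≃ Fin Q) : Op Λ q ≃ₐ[ℂ] Op B Q :=
  Matrix.reindexAlgEquiv ℂ ℂ (superCfg e κ)

omit [Fintype F] [DecidableEq F] in
/-- Entries of `superOp e κ O`. -/
theorem superOp_apply (e : Λ ≃ B × F) (κ : TensorIndex F q ≃ Fin Q) (O : Op Λ q)
    (τ τ' : TensorIndex B Q) :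
    superOp e κ O τ τ' = O ((superCfg e κ).symm τ) ((superCfg e κ).symm τ') := rfl

/-- **A product operator blocks to the product operator of the cell words**:
`superOp (⨂_x u_x) = ⨂_b superSite κ (⨂_f u_{e⁻¹(b,f)})`. -/
theorem superOp_productOp (e : Λ ≃ B × F) (κ : TensorIndex F q ≃ Fin Q)
    (u : Λ → Matrix (Fin q) (Fin q) ℂ) :
    superOp e κ (productOp u) =
      productOp fun b => superSite κ (productOp fun f => u (e.symm (b, f))) := by
  ext τ τ'
  rw [superOp_apply, productOp_apply, productOp_apply]
  simp only [superSite_apply, productOp_apply]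
  rw [← Equiv.prod_comp e.symm (fun x => u x ((superCfg e κ).symm τ x) ((superCfg e κ).symm τ' x)),
    Fintype.prod_prod_type]
  simp only [superCfg_symm_apply_symm]

/-- A cell none of whose sites carries a non-trivial factor gets the identity. -/
theorem superSite_productOp_eq_one (κ : TensorIndex F q ≃ Fin Q) {v : F → Matrix (Fin q) (Fin q) ℂ}
    (h : ∀ f, v f = 1) : superSite κ (productOp v) = 1 := by
  rw [show v = fun _ => (1 : Matrix (Fin q) (Fin q) ℂ) from funext h, productOp_one, map_one]

/-- A product operator whose factors are trivial off one site is a single-site operator. -/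
theorem productOp_eq_onSite {v : B → Matrix (Fin Q) (Fin Q) ℂ} (b₀ : B)
    (h : ∀ b, b ≠ b₀ → v b = 1) : productOp v = onSite b₀ (v b₀) := by
  rw [onSite_eq_productOp]
  congr 1
  funext b
  by_cases hb : b = b₀
  · subst hb; rw [Function.update_self]
  · rw [Function.update_of_ne hb, h b hb]

/-- A product operator whose factors are trivial off two sites is a product of two single-site
operators. -/
theorem productOp_eq_onSite_mul_onSite {v : B → Matrix (Fin Q) (Fin Q) ℂ} {b₀ b₁ : B} (hne : b₀ ≠ b₁)
    (h : ∀ b, b ≠ b₀ → b ≠ b₁ → v b = 1) :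
    productOp v = onSite b₀ (v b₀) * onSite b₁ (v b₁) := by
  rw [onSite_mul_onSite_eq_productOp hne]
  congr 1
  funext b
  by_cases hb0 : b = b₀
  · subst hb0; rw [Function.update_self]
  · rw [Function.update_of_ne hb0]
    by_cases hb1 : b = b₁
    · subst hb1; rw [Function.update_self]
    · rw [Function.update_of_ne hb1, h b hb0 hb1]

/-- **One-cell words.** A product operator supported in the cell `b₀` blocks to a single-site operator
of the cell chain. -/
theorem superOp_productOp_of_support (e : Λ ≃ B × F) (κ : TensorIndex F q ≃ Fin Q)
    (u : Λ → Matrix (Fin q) (Fin q) ℂ) (b₀ : B) (h : ∀ x, (e x).1 ≠ b₀ → u x = 1) :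
    superOp e κ (productOp u) =
      onSite b₀ (superSite κ (productOp fun f => u (e.symm (b₀, f)))) := by
  rw [superOp_productOp]
  refine productOp_eq_onSite b₀ fun b hb => superSite_productOp_eq_one κ fun f => h _ ?_
  rw [Equiv.apply_symm_apply]
  exact hb

/-- **Two-cell words.** A product operator supported in the cells `b₀ ≠ b₁` blocks to a product of two
single-site operators of the cell chain. -/
theorem superOp_productOp_of_support₂ (e : Λ ≃ B × F) (κ : TensorIndex F q ≃ Fin Q)
    (u : Λ → Matrix (Fin q) (Fin q) ℂ) {b₀ b₁ : B} (hne : b₀ ≠ b₁)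
    (h : ∀ x, (e x).1 ≠ b₀ → (e x).1 ≠ b₁ → u x = 1) :
    superOp e κ (productOp u) =
      onSite b₀ (superSite κ (productOp fun f => u (e.symm (b₀, f)))) *
        onSite b₁ (superSite κ (productOp fun f => u (e.symm (b₁, f)))) := by
  rw [superOp_productOp]
  refine productOp_eq_onSite_mul_onSite hne fun b hb0 hb1 =>
    superSite_productOp_eq_one κ fun f => h _ ?_ ?_
  · rw [Equiv.apply_symm_apply]; exact hb0
  · rw [Equiv.apply_symm_apply]; exact hb1

/-- **Blocking a single-site operator**: `superOp (onSite x a) = onSite (e x).1 (superSite (onSite (e x).2 a))`. -/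
theorem superOp_onSite (e : Λ ≃ B × F) (κ : TensorIndex F q ≃ Fin Q) (x : Λ)
    (a : Matrix (Fin q) (Fin q) ℂ) :
    superOp e κ (onSite x a) = onSite (e x).1 (superSite κ (onSite (e x).2 a)) := by
  have hfam : (fun f => Function.update (fun _ => (1 : Matrix (Fin q) (Fin q) ℂ)) x a (e.symm ((e x).1, f))) =
      Function.update (fun _ => (1 : Matrix (Fin q) (Fin q) ℂ)) (e x).2 a := by
    funext f
    by_cases hf : f = (e x).2
    · rw [hf, Function.update_self, show ((e x).1, (e x).2) = e x from rfl, Equiv.symm_apply_apply,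
        Function.update_self]
    · rw [Function.update_of_ne hf, Function.update_of_ne]
      intro hx
      apply hf
      have := congrArg (fun y => (e y).2) hx
      simpa using this
  rw [onSite_eq_productOp, superOp_productOp_of_support e κ _ (e x).1, hfam, ← onSite_eq_productOp]
  intro x' hx'
  rw [Function.update_of_ne]
  rintro rfl
  exact hx' rfl

omit [Fintype F] [DecidableEq F] in
/-- `a ↦ onSite b a` commutes with finite sums. -/
theorem onSite_sum_eq {ι : Type*} (b : B) (s : Finset ι) (a : ι → Matrix (Fin Q) (Fin Q) ℂ) :
    (onSite b (∑ i ∈ s, a i) : Op B Q) = ∑ i ∈ s, onSite b (a i) :=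
  map_sum (AddMonoidHom.mk' (fun a => (onSite b a : Op B Q)) (onSite_add' b)) a s

/-- **Blocking a sum of single-site operators**, cell by cell:
`superOp (Σ_x (g x)_x) = Σ_b onSite b (superSite (Σ_f (g (e⁻¹(b,f)))_f))`. -/
theorem superOp_sum_onSite (e : Λ ≃ B × F) (κ : TensorIndex F q ≃ Fin Q)
    (g : Λ → Matrix (Fin q) (Fin q) ℂ) :
    superOp e κ (∑ x, onSite x (g x)) =
      ∑ b, onSite b (superSite κ (∑ f, onSite f (g (e.symm (b, f))))) := by
  rw [map_sum, ← Equiv.sum_comp e.symm (fun x => superOp e κ (onSite x (g x))), Fintype.sum_prod_type]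
  refine Finset.sum_congr rfl fun b _ => ?_
  rw [map_sum, onSite_sum_eq]
  refine Finset.sum_congr rfl fun f _ => ?_
  rw [superOp_onSite, Equiv.apply_symm_apply]

omit [Fintype F] [DecidableEq F] in
/-- Quadratic forms are invariant under blocking:
`⟨φ ∘ s⁻¹, superOp O (ψ ∘ s⁻¹)⟩ = ⟨φ, O ψ⟩` (`s = superCfg e κ`). -/
theorem star_dotProduct_superOp_mulVec (e : Λ ≃ B × F) (κ : TensorIndex F q ≃ Fin Q) (O : Op Λ q)
    (φ ψ : TensorIndex Λ q → ℂ) :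
    star (fun τ => φ ((superCfg e κ).symm τ)) ⬝ᵥ
        (superOp e κ O *ᵥ fun τ => ψ ((superCfg e κ).symm τ)) = star φ ⬝ᵥ (O *ᵥ ψ) := by
  simp only [dotProduct, Matrix.mulVec, Pi.star_apply, superOp_apply]
  rw [← Equiv.sum_comp (superCfg e κ).symm]
  refine Finset.sum_congr rfl fun τ _ => ?_
  congr 1
  exact Equiv.sum_comp (superCfg e κ).symm (fun σ' => O ((superCfg e κ).symm τ) σ' * ψ σ')

omit [Fintype F] [DecidableEq F] in
/-- Quadratic forms along blocking, cell-side form: for vectors `φ, ψ` on the CELL chain,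
`⟨φ ∘ s, O (ψ ∘ s)⟩ = ⟨φ, superOp O ψ⟩` (`s = superCfg e κ`). -/
theorem star_comp_superCfg_dotProduct_mulVec (e : Λ ≃ B × F) (κ : TensorIndex F q ≃ Fin Q)
    (O : Op Λ q) (φ ψ : TensorIndex B Q → ℂ) :
    star (fun σ => φ (superCfg e κ σ)) ⬝ᵥ (O *ᵥ fun σ => ψ (superCfg e κ σ)) =
      star φ ⬝ᵥ (superOp e κ O *ᵥ ψ) := by
  have h := star_dotProduct_superOp_mulVec e κ O (fun σ => φ (superCfg e κ σ))
    (fun σ => ψ (superCfg e κ σ))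
  simp only [Equiv.apply_symm_apply] at h
  exact h.symm

omit [Fintype F] [DecidableEq F] in
/-- Norms along blocking: `‖φ ∘ s‖² = ‖φ‖²`. -/
theorem star_comp_superCfg_dotProduct_self (e : Λ ≃ B × F) (κ : TensorIndex F q ≃ Fin Q)
    (φ : TensorIndex B Q → ℂ) :
    star (fun σ => φ (superCfg e κ σ)) ⬝ᵥ (fun σ => φ (superCfg e κ σ)) = star φ ⬝ᵥ φ := by
  have h := star_comp_superCfg_dotProduct_mulVec e κ 1 φ φ
  rwa [Matrix.one_mulVec, map_one, Matrix.one_mulVec] at h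

end Blocking

/-! ### Jordan–Wigner words as product operators -/

section Words

open Literature.MathematicalPhysics.QuantumLattice.JordanWigner

variable {Λ : Type*} [LinearOrder Λ] [Fintype Λ]

/-- The family of the string `F_{string x} F_{string y}`: the parity `F` on the sites `z` with
`x ≤ z < y` or `y ≤ z < x` (i.e. on `[min, max)`), the identity elsewhere. -/
def stringFamily (x y : Λ) : Λ → Matrix (Fin 4) (Fin 4) ℂ :=
  fun z => if (x ≤ z ∧ z < y) ∨ (y ≤ z ∧ z < x) then siteParity else 1

/-- The family of the hopping word `A_x · (F_{string x} F_{string y}) · B_y` (`x ≠ y`): the string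
family with its factor at `x` multiplied by `A` on the left and its factor at `y` by `B` on the right
(so for `x < y`: `A F` at `x`, `F` strictly between, `B` at `y`; for `y < x`: `F B` at `y`, `F` strictly
between, `A` at `x`). -/
def jwWordFamily (x y : Λ) (A B : Matrix (Fin 4) (Fin 4) ℂ) : Λ → Matrix (Fin 4) (Fin 4) ℂ :=
  Function.update (Function.update (stringFamily x y) x (A * stringFamily x y x)) y
    (stringFamily x y y * B)

/-- `F_{string x} F_{string y} = ⨂ stringFamily x y`. -/
theorem jwString_mul_jwString_eq_productOp (x y : Λ) :
    jwString x * jwString y = productOp (stringFamily x y) := by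
  rcases le_total x y with h | h
  · rw [jwString_mul_jwString_of_le h]
    congr 1; funext z; unfold stringFamily
    by_cases h1 : x ≤ z ∧ z < y
    · rw [if_pos h1, if_pos (Or.inl h1)]
    · rw [if_neg h1, if_neg]
      rintro (h2 | h2)
      · exact h1 h2
      · exact absurd (lt_of_le_of_lt h (lt_of_le_of_lt h2.1 h2.2)) (lt_irrefl _)
  · rw [jwString_comm, jwString_mul_jwString_of_le h]
    congr 1; funext z; unfold stringFamily
    by_cases h1 : y ≤ z ∧ z < x
    · rw [if_pos h1, if_pos (Or.inr h1)]
    · rw [if_neg h1, if_neg]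
      rintro (h2 | h2)
      · exact absurd (lt_of_le_of_lt h (lt_of_le_of_lt h2.1 h2.2)) (lt_irrefl _)
      · exact h1 h2

omit [LinearOrder Λ] in
/-- `A_x · ⨂ u = ⨂ (u with u_x ↦ A u_x)`. -/
theorem onSite_mul_productOp [DecidableEq Λ] {q : ℕ} (x : Λ) (A : Matrix (Fin q) (Fin q) ℂ)
    (u : Λ → Matrix (Fin q) (Fin q) ℂ) :
    onSite x A * productOp u = productOp (Function.update u x (A * u x)) := by
  rw [onSite_eq_productOp, productOp_mul]
  congr 1
  funext z
  by_cases hz : z = x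
  · subst hz; rw [Function.update_self, Function.update_self]
  · rw [Function.update_of_ne hz, Function.update_of_ne hz, Matrix.one_mul]

omit [LinearOrder Λ] in
/-- `⨂ u · B_y = ⨂ (u with u_y ↦ u_y B)`. -/
theorem productOp_mul_onSite [DecidableEq Λ] {q : ℕ} (y : Λ) (B : Matrix (Fin q) (Fin q) ℂ)
    (u : Λ → Matrix (Fin q) (Fin q) ℂ) :
    productOp u * onSite y B = productOp (Function.update u y (u y * B)) := by
  rw [onSite_eq_productOp, productOp_mul]
  congr 1
  funext z
  by_cases hz : z = y
  · subst hz; rw [Function.update_self, Function.update_self]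
  · rw [Function.update_of_ne hz, Function.update_of_ne hz, Matrix.mul_one]

/-- **A hopping word is a product operator**: `A_x (F_{string x} F_{string y}) B_y = ⨂ jwWordFamily x y A B`
(`x ≠ y`). -/
theorem onSite_mul_jwString_mul_jwString_mul_onSite {x y : Λ} (hxy : x ≠ y)
    (A B : Matrix (Fin 4) (Fin 4) ℂ) :
    onSite x A * (jwString x * jwString y) * onSite y B = productOp (jwWordFamily x y A B) := by
  rw [jwString_mul_jwString_eq_productOp, onSite_mul_productOp, productOp_mul_onSite, jwWordFamily,
    Function.update_of_ne hxy.symm]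

/-- **`toSpin (c†_{xσ} c_{yτ}) = ⨂ jwWordFamily x y c†_σ c_τ`** (`x ≠ y`).
[cite: EsslerEtAl2005, §12.3.4 eqs. (12.198)–(12.201)] -/
theorem toSpin_creation_mul_annihilation_eq_productOp {x y : Λ} (hxy : x ≠ y) (σ τ : Fin 2) :
    toSpin (creation (orb x σ) * annihilation (orb y τ)) =
      productOp (jwWordFamily x y (siteCreation σ) (siteAnnihilation τ)) := by
  rw [toSpin_creation_mul_annihilation, onSite_mul_jwString_mul_jwString_mul_onSite hxy]

/-! #### Transport of words along an order embedding with order-connected range -/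

variable {F : Type*} [LinearOrder F]

omit [Fintype Λ] in
/-- The string family is transported along an order embedding. -/
theorem stringFamily_orderEmbedding (ι : F ↪o Λ) (p p' f : F) :
    stringFamily (ι p) (ι p') (ι f) = stringFamily p p' f := by
  simp only [stringFamily, ι.le_iff_le, ι.lt_iff_lt]

omit [Fintype Λ] in
/-- **Words restrict to the cell**: along an order embedding `ι`,
`jwWordFamily (ι p) (ι p') A B (ι f) = jwWordFamily p p' A B f`. -/
theorem jwWordFamily_orderEmbedding (ι : F ↪o Λ) (p p' f : F) (A B : Matrix (Fin 4) (Fin 4) ℂ) :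
    jwWordFamily (ι p) (ι p') A B (ι f) = jwWordFamily p p' A B f := by
  simp only [jwWordFamily, Function.update_apply, EmbeddingLike.apply_eq_iff_eq,
    stringFamily_orderEmbedding]

omit [Fintype Λ] in
/-- **Words are trivial off an interval cell**: if the range of `ι` is order-connected, then
`jwWordFamily (ι p) (ι p') A B z = 1` for every `z` outside the range. -/
theorem jwWordFamily_eq_one_of_not_mem_range (ι : F ↪o Λ) (hι : (Set.range ι).OrdConnected)
    (p p' : F) (A B : Matrix (Fin 4) (Fin 4) ℂ) {z : Λ} (hz : z ∉ Set.range ι) :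
    jwWordFamily (ι p) (ι p') A B z = 1 := by
  have hp : z ≠ ι p := fun h => hz ⟨p, h.symm⟩
  have hp' : z ≠ ι p' := fun h => hz ⟨p', h.symm⟩
  rw [jwWordFamily, Function.update_of_ne hp', Function.update_of_ne hp, stringFamily, if_neg]
  rintro (⟨h1, h2⟩ | ⟨h1, h2⟩)
  · exact hz (hι.out ⟨p, rfl⟩ ⟨p', rfl⟩ ⟨h1, h2.le⟩)
  · exact hz (hι.out ⟨p', rfl⟩ ⟨p, rfl⟩ ⟨h1, h2.le⟩)

variable [Fintype F] {B : Type*} [Fintype B] [DecidableEq B] {Q : ℕ}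

/-- **A hopping word inside an interval cell blocks to a one-cell operator.** Let `e : Λ ≃ B × F` be a
cell decomposition whose cell `b₀` is embedded by the order embedding `ι` (`e⁻¹ (b₀, f) = ι f`) with
order-connected range. Then for sites `p, p'` of that cell
`superOp (⨂ jwWordFamily (ι p) (ι p') A B) = onSite b₀ (superSite (⨂ jwWordFamily p p' A B))`. -/
theorem superOp_productOp_jwWordFamily_cell (e : Λ ≃ B × F) (κ : TensorIndex F 4 ≃ Fin Q) (b₀ : B)
    (ι : F ↪o Λ) (hι : ∀ f, e.symm (b₀, f) = ι f) (hconn : (Set.range ι).OrdConnected) (p p' : F)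
    (A B' : Matrix (Fin 4) (Fin 4) ℂ) :
    superOp e κ (productOp (jwWordFamily (ι p) (ι p') A B')) =
      onSite b₀ (superSite κ (productOp (jwWordFamily p p' A B'))) := by
  rw [superOp_productOp_of_support e κ _ b₀]
  · congr 3
    funext f
    rw [hι, jwWordFamily_orderEmbedding]
  · intro x hx
    refine jwWordFamily_eq_one_of_not_mem_range ι hconn p p' A B' ?_
    rintro ⟨f, hf⟩
    apply hx
    rw [← hf, ← hι, Equiv.apply_symm_apply]

end Words

end Summit.Ventures.CertifiedManyBodySolver.Upper

end
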